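import Summits.RiemannHypothesis.RiemannHypothesis.Theorems.MotivicDoorFfWeilConverse
import Summits.RiemannHypothesis.RiemannHypothesis.Theorems.PfPersistenceFfDialPrefix

/-!
# Motivic door, function-field side (C)(i), part 2: THE FF-DOOR THEOREM — window-local predicates of the
explicit-formula tower are matched by honest fakes, unless they ARE the Riemann hypothesis
(pub-rhdoor seat ff-1.  HONEST FRAMING: lottery ticket at the motivic door; RH probability negligible;
consolation prizes are real — this is the ff-door theorem (i).  Nothing here concerns `ζ`: "RH(q,h)" is the
function-field Riemann hypothesis `|α| = √q` for the roots of ONE integer polynomial `h`, always a hypothesis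
or a conclusion of a theorem about that polynomial; GEOMETRIC ORIGIN is an ABSTRACT predicate
`Geo : ℤ[X] → Prop` and the two theorems of arithmetic geometry that concern it — WEIL (`Geo h → RH(q,h)`) and
HONDA–TATE in power form (`h` honest with RH ⇒ `Geo (h^E)` for some `E ≥ 1`) — enter ONLY as explicit
hypotheses `hW`, `hHT` (to be discharged from the Literature layer by seat ff-2; never asserted here).)

Objects (pub-rhpf ffmirror-1/2, `PfPersistenceFfAngleTwin`, `…FfDialPrefix`, `…FfGram`; part 1
`MotivicDoorFfWeilConverse`): a datum `(q,h)`, `q ≥ 1`, `h ∈ ℤ[X]`; its window tower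
`weilWindowTower q h : Tower`, `M ↦ T_M(q,h) = (K(|m-m'|))_{m,m' ≤ M}`; a PREDICATE (reader) `Φ : Tower → Prop`.
HONEST of dimension `g` = monic, `natDegree h = 2g`, functional equation `q^g c_j = q^i c_i (i+j=2g)`.
Two classes of readers (the class-𝒞 analogue): FINITE-WINDOW (`Φ` depends on `T_0,…,T_M` only: hypothesis
`hloc`) and SCALE-FREE (`Φ (c • T) = Φ T` for `c > 0`: hypothesis `hΦ`, ffmirror-2's convention).

QUANTIFIERS FIRST (§0).  The charter sentence "every window-local predicate true of all genuine zeta functions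
is matched by an honest fake, OR it implies RH" has two literal readings and neither is the theorem:
READING A (the fake may violate RH) is a propositional TAUTOLOGY (`readingA_tautology`); READING B (the fake
must satisfy RH and be non-geometric) is FALSE for general predicates (`readingB_fails`, witness predicate
"geometric tower ∨ tower of an honest RH-false datum", using part 1).  The content is in the CLASS of `Φ`:

* §2 FINITE-WINDOW READERS NEVER CERTIFY RH (`finiteWindow_matched_by_rhFalse`,
  `finiteWindow_never_certifies_ffRH`): at `q ≥ 2`, a reader of the windows `T_0..T_M` that accepts one honest
  datum of dimension `g ≥ M+1` accepts an honest RH-FALSE datum of the same dimension (the dial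
  `h + k x^g`, `k = -h(1)`, plants the root `1`); so every finite-window predicate true on all geometric data
  is matched by an honest RH-false fake — reading A's first branch ALWAYS holds.
* §3 SCALE-FREE READERS SEE EXACTLY RH (`scaleFree_accepts_of_ffRH`, `scaleFree_hull_iff_ffRH`,
  `scaleFree_dichotomy`, `ffDoor_scaleFree`): under Honda–Tate, a scale-free reader true on all geometric data
  accepts EVERY honest RH-true datum, geometric or not (matched by all RH-true fakes — reading B's first branch
  in the strongest form); hence the DICHOTOMY: it accepts an honest RH-false datum, OR it is EQUIVALENT to RH on
  honest data; and (with Weil and part 1) the intersection of all scale-free geometric predicates on honest data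
  is exactly RH — the tower modulo scale carries RH and nothing finer.

What (i) says about the number-field door (FF-DOOR.md §(i)): in the model, a class-𝒞 certificate of RH must
read infinitely many windows and is then, on honest data, equivalent to full Weil positivity; no cheaper local
or scale-free certificate exists, and no such reader separates "geometric" from "honest + RH".
-/

set_option linter.dupNamespace false

noncomputable section

open Polynomial
open scoped ComplexOrder

open Summit.RiemannHypothesis.RiemannHypothesis.Theorems.PfPersistence.FfAngleTwin

namespace Summit.RiemannHypothesis.RiemannHypothesis.Theorems.MotivicDoor.FunctionField

/-! ## 0. Quantifiers: the two literal readings of "(matched by an honest fake) ∨ (implies RH)" -/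

/-- READING A (fakes may violate RH) is a TAUTOLOGY, for every notion of honesty `Hon`, every property `Rh`
and every predicate `Φ` on any type: some honest `Rh`-false object satisfies `Φ`, or every honest object
satisfying `Φ` satisfies `Rh`.  No arithmetic input. [folklore] -/
theorem readingA_tautology {ι : Sort*} (Hon Rh Φ : ι → Prop) :
    (∃ x, Hon x ∧ ¬ Rh x ∧ Φ x) ∨ (∀ x, Hon x → Φ x → Rh x) :=
  or_iff_not_imp_left.2 fun H x hx hΦ => by_contra fun hR => H ⟨x, hx, hR, hΦ⟩

/-- A monic integer polynomial vanishing at `1` has `1` among its complex roots. [folklore] -/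
theorem one_mem_frobRoots {h : ℤ[X]} (hh : h.Monic) (h1 : h.eval 1 = 0) : (1 : ℂ) ∈ frobRoots h := by
  unfold frobRoots
  rw [Polynomial.mem_roots (hh.map _).ne_zero, Polynomial.IsRoot.def, Polynomial.eval_one_map, h1, map_zero]

/-- … hence violates RH(q,h) as soon as `q ≥ 2` (`|1| = 1 < √q`). [folklore] -/
theorem not_ffRH_of_eval_one {q : ℕ} (hq : 2 ≤ q) {h : ℤ[X]} (hh : h.Monic) (h1 : h.eval 1 = 0) :
    ¬ ∀ α ∈ frobRoots h, ‖α‖ = Real.sqrt q := by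
  intro hRH
  have h2 := hRH 1 (one_mem_frobRoots hh h1)
  rw [norm_one] at h2
  have hlt : (1 : ℝ) < Real.sqrt q := by
    rw [← Real.sqrt_one]
    exact Real.sqrt_lt_sqrt zero_le_one (by exact_mod_cast (hq : 1 < q))
  exact absurd h2 hlt.ne

/-- An honest RH-false datum exists in dimension `1` at every `q`: `h₀ = (X-1)(X-q) = X² - (q+1)X + q`
(monic, degree `2`, functional equation, root `1`). [folklore] -/
theorem exists_honest_eval_one_eq_zero (q : ℕ) :
    ∃ h : ℤ[X], h.Monic ∧ h.natDegree = 2 * 1 ∧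
      (∀ i j, i + j = 2 * 1 → (q : ℤ) ^ 1 * h.coeff j = (q : ℤ) ^ i * h.coeff i) ∧ h.eval 1 = 0 := by
  have hmon : ((X - C 1) * (X - C (q : ℤ)) : ℤ[X]).Monic := (monic_X_sub_C 1).mul (monic_X_sub_C _)
  have hdeg : ((X - C 1) * (X - C (q : ℤ)) : ℤ[X]).natDegree = 2 * 1 := by
    rw [natDegree_mul (X_sub_C_ne_zero 1) (X_sub_C_ne_zero _), natDegree_X_sub_C, natDegree_X_sub_C]
  have h2 : ((X - C 1) * (X - C (q : ℤ)) : ℤ[X]).coeff 2 = 1 := by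
    have := hmon.coeff_natDegree; rwa [hdeg] at this
  have h0 : ((X - C 1) * (X - C (q : ℤ)) : ℤ[X]).coeff 0 = q := by
    rw [coeff_zero_eq_eval_zero]; simp
  refine ⟨(X - C 1) * (X - C (q : ℤ)), hmon, hdeg, ?_, by simp⟩
  intro i j hij
  have hi : i ≤ 2 := by omega
  interval_cases i
  · obtain rfl : j = 2 := by omega
    rw [h2, h0]; ring
  · obtain rfl : j = 1 := by omega
    ring
  · obtain rfl : j = 0 := by omega
    rw [h2, h0]; ring

/-- READING B (the matching fake must satisfy RH and have a NON-GEOMETRIC tower) is FALSE for general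
predicates — at every `q ≥ 2` and for EVERY notion `Geo` of geometric origin.  Witness predicate: "is the tower
of a geometric datum, or the tower of an honest RH-false datum"; it is true on all geometric data; no honest
RH-true datum with a non-geometric tower satisfies it (an RH-true and an RH-false honest datum never share a
tower: the tower carries exactly RH, part 1); and it does not imply RH (the datum of
`exists_honest_eval_one_eq_zero`).  So the door theorem must restrict the CLASS of predicates (§2, §3).
[folklore] -/
theorem readingB_fails (Geo : ℤ[X] → Prop) {q : ℕ} (hq : 2 ≤ q) :
    ∃ Φ : Tower → Prop, (∀ h, Geo h → Φ (weilWindowTower (q : ℝ) h)) ∧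
      ¬ ((∃ (g : ℕ) (h' : ℤ[X]), 1 ≤ g ∧ h'.Monic ∧ h'.natDegree = 2 * g ∧
            (∀ i j, i + j = 2 * g → (q : ℤ) ^ g * h'.coeff j = (q : ℤ) ^ i * h'.coeff i) ∧
            (∀ α ∈ frobRoots h', ‖α‖ = Real.sqrt q) ∧
            (∀ h, Geo h → weilWindowTower (q : ℝ) h' ≠ weilWindowTower (q : ℝ) h) ∧
            Φ (weilWindowTower (q : ℝ) h')) ∨
         (∀ (g : ℕ) (h' : ℤ[X]), 1 ≤ g → h'.Monic → h'.natDegree = 2 * g →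
            (∀ i j, i + j = 2 * g → (q : ℤ) ^ g * h'.coeff j = (q : ℤ) ^ i * h'.coeff i) →
            Φ (weilWindowTower (q : ℝ) h') → ∀ α ∈ frobRoots h', ‖α‖ = Real.sqrt q)) := by
  have hq0 : 0 < q := by omega
  obtain ⟨h₀, hmon₀, hdeg₀, hFE₀, hev₀⟩ := exists_honest_eval_one_eq_zero q
  have hnRH₀ := not_ffRH_of_eval_one hq hmon₀ hev₀
  refine ⟨fun T => (∃ h, Geo h ∧ T = weilWindowTower (q : ℝ) h) ∨
      (∃ (g : ℕ) (h : ℤ[X]), h.natDegree = 2 * g ∧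
        (∀ i j, i + j = 2 * g → (q : ℤ) ^ g * h.coeff j = (q : ℤ) ^ i * h.coeff i) ∧
        (¬ ∀ α ∈ frobRoots h, ‖α‖ = Real.sqrt q) ∧ T = weilWindowTower (q : ℝ) h),
    fun h hG => Or.inl ⟨h, hG, rfl⟩, ?_⟩
  rintro (⟨g, h', -, -, -, -, hRH, hng, hΦ⟩ | H)
  · rcases hΦ with ⟨h, hG, hEq⟩ | ⟨g₁, h₁, hdeg₁, hFE₁, hnRH₁, hEq⟩
    · exact hng h hG hEq
    · refine hnRH₁ (ffRH_of_weilWindowForm_posSemidef hq0 hdeg₁ hFE₁ fun M => ?_)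
      have hM : weilWindowForm (q : ℝ) h₁ M = weilWindowForm (q : ℝ) h' M := by
        change weilWindowTower (q : ℝ) h₁ M = weilWindowTower (q : ℝ) h' M
        rw [hEq]
      rw [hM]
      exact weilWindowForm_posSemidef (by exact_mod_cast hq0) hRH M
  · exact hnRH₀ (H 1 h₀ le_rfl hmon₀ hdeg₀ hFE₀ (Or.inr ⟨1, h₀, hdeg₀, hFE₀, hnRH₀, rfl⟩))

/-! ## 1. Tower bookkeeping -/

/-- The corner entry `(0, n)` of the window `T_n` is the symbol `K(n)`. [folklore] -/
theorem weilWindowTower_corner (q : ℝ) (h : ℤ[X]) (n : ℕ) :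
    weilWindowTower q h n 0 (Fin.last n) = ffKernel q (frobRoots h) n := by
  simp only [weilWindowTower, ffWindowTower, ffWindowForm, Matrix.of_apply, Fin.val_zero, Fin.val_last,
    Nat.dist_zero_left]

/-- The window `T_0` is the `1 × 1` matrix `(K(0)) = (g)`. [folklore] -/
theorem weilWindowTower_corner_zero (q : ℝ) (h : ℤ[X]) :
    weilWindowTower q h 0 0 0 = ffKernel q (frobRoots h) 0 := by
  simp only [weilWindowTower, ffWindowTower, ffWindowForm, Matrix.of_apply, Fin.val_zero, Nat.dist_self]

/-- The MINOR READER `T ↦ (∀ n, |T_n(0,n)| ≤ |T_0(0,0)|)` (all `2 × 2` corner minors) is scale-free. [folklore] -/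
theorem minorReader_scaleInvariant (c : ℝ) (hc : 0 < c) (T : Tower) :
    (∀ n, ‖Tower.scale c T n 0 (Fin.last n)‖ ≤ ‖Tower.scale c T 0 0 0‖)
      = (∀ n, ‖T n 0 (Fin.last n)‖ ≤ ‖T 0 0 0‖) := by
  refine propext (forall_congr' fun n => ?_)
  simp only [Tower.scale, Matrix.smul_apply, smul_eq_mul, norm_mul, Complex.norm_real, Real.norm_eq_abs,
    abs_of_pos hc]
  exact ⟨fun h => le_of_mul_le_mul_left h hc, fun h => mul_le_mul_of_nonneg_left h hc.le⟩

/-- The dial `h ↦ h + k x^g` preserves the functional equation (it moves only the self-paired central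
coefficient `c_g`). [folklore] -/
theorem fe_dial {q : ℕ} {h : ℤ[X]} {g : ℕ}
    (hFE : ∀ i j, i + j = 2 * g → (q : ℤ) ^ g * h.coeff j = (q : ℤ) ^ i * h.coeff i) (k : ℤ) :
    ∀ i j, i + j = 2 * g →
      (q : ℤ) ^ g * (h + C k * X ^ g).coeff j = (q : ℤ) ^ i * (h + C k * X ^ g).coeff i := by
  intro i j hij
  simp only [coeff_add, coeff_C_mul_X_pow]
  by_cases hi : i = g
  · subst hi
    obtain rfl : j = i := by omega
    rfl
  · have hj : j ≠ g := fun hj => hi (by omega)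
    rw [if_neg hj, if_neg hi, add_zero, add_zero]
    exact hFE i j hij

/-! ## 2. Finite-window readers never certify RH -/

/-- FINITE-WINDOW READERS ARE MATCHED BY HONEST RH-FALSE FAKES.  Let `Φ` read only the windows `T_0,…,T_M`
(`hloc`) and accept an honest datum `(q,h)` of dimension `g ≥ M+1`, `q ≥ 2`.  Then `Φ` accepts an honest
datum `(q,h')` of the same dimension that VIOLATES RH: `h' = h - h(1)·x^g` has the root `1` and the same first
`g` windows (ffmirror-1's dial-blind prefix). [folklore] -/
theorem finiteWindow_matched_by_rhFalse {Φ : Tower → Prop} {M : ℕ}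
    (hloc : ∀ T T' : Tower, (∀ M' ≤ M, T M' = T' M') → Φ T → Φ T')
    {q : ℕ} (hq : 2 ≤ q) {g : ℕ} (hM : M + 1 ≤ g) {h : ℤ[X]} (hh : h.Monic)
    (hdeg : h.natDegree = 2 * g)
    (hFE : ∀ i j, i + j = 2 * g → (q : ℤ) ^ g * h.coeff j = (q : ℤ) ^ i * h.coeff i)
    (hΦ : Φ (weilWindowTower (q : ℝ) h)) :
    ∃ h' : ℤ[X], h'.Monic ∧ h'.natDegree = 2 * g ∧
      (∀ i j, i + j = 2 * g → (q : ℤ) ^ g * h'.coeff j = (q : ℤ) ^ i * h'.coeff i) ∧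
      (¬ ∀ α ∈ frobRoots h', ‖α‖ = Real.sqrt q) ∧ Φ (weilWindowTower (q : ℝ) h') := by
  have hg : 1 ≤ g := le_trans (Nat.le_add_left 1 M) hM
  obtain ⟨hmon, hdeg'⟩ := monic_dial hh hdeg hg (-(h.eval 1))
  refine ⟨h + C (-(h.eval 1)) * X ^ g, hmon, hdeg', fe_dial hFE _, not_ffRH_of_eval_one hq hmon ?_, ?_⟩
  · simp [eval_add, eval_mul, eval_pow, eval_X]
  · refine hloc _ _ (fun M' hM' => ?_) hΦ
    change weilWindowForm (q : ℝ) h M' = weilWindowForm (q : ℝ) (h + C (-(h.eval 1)) * X ^ g) M'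
    exact (weilWindowForm_dial (q : ℝ) hh hdeg (-(h.eval 1)) (M := M') (by omega)).symm

/-- FF-DOOR (i), FINITE-WINDOW HALF: every finite-window predicate true on all geometric data is satisfied by
an honest datum violating RH — provided geometric honest data exist in some dimension `≥ M+1` (`hlarge`; e.g.
powers of one elliptic curve — discharged by seat ff-2).  Such a predicate can never imply RH. [folklore] -/
theorem finiteWindow_never_certifies_ffRH {Φ : Tower → Prop} {M : ℕ}
    (hloc : ∀ T T' : Tower, (∀ M' ≤ M, T M' = T' M') → Φ T → Φ T')
    {Geo : ℤ[X] → Prop} {q : ℕ} (hq : 2 ≤ q)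
    (hlarge : ∃ (g : ℕ) (h : ℤ[X]), M + 1 ≤ g ∧ Geo h ∧ h.Monic ∧ h.natDegree = 2 * g ∧
      ∀ i j, i + j = 2 * g → (q : ℤ) ^ g * h.coeff j = (q : ℤ) ^ i * h.coeff i)
    (hGeo : ∀ h, Geo h → Φ (weilWindowTower (q : ℝ) h)) :
    ∃ (g : ℕ) (h' : ℤ[X]), M + 1 ≤ g ∧ h'.Monic ∧ h'.natDegree = 2 * g ∧
      (∀ i j, i + j = 2 * g → (q : ℤ) ^ g * h'.coeff j = (q : ℤ) ^ i * h'.coeff i) ∧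
      (¬ ∀ α ∈ frobRoots h', ‖α‖ = Real.sqrt q) ∧ Φ (weilWindowTower (q : ℝ) h') := by
  obtain ⟨g, h, hMg, hG, hh, hdeg, hFE⟩ := hlarge
  obtain ⟨h', h1, h2, h3, h4, h5⟩ := finiteWindow_matched_by_rhFalse hloc hq hMg hh hdeg hFE (hGeo h hG)
  exact ⟨g, h', hMg, h1, h2, h3, h4, h5⟩

/-! ## 3. Scale-free readers see exactly RH -/

/-- SCALE-FREE READERS ACCEPT EVERY HONEST RH-TRUE DATUM.  Under Honda–Tate in power form (`hHT`), a
scale-free reader (`hΦ`) true on all geometric data (`hGeo`) accepts every honest datum satisfying RH —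
geometric or not: `Φ(T(q,h)) = Φ(T(q,h^E)) = Φ(E · T(q,h))` (ffmirror-2's power-twin lemma).  I.e. such a
reader is matched by EVERY honest RH-true fake. [folklore] -/
theorem scaleFree_accepts_of_ffRH {Φ : Tower → Prop}
    (hΦ : ∀ c : ℝ, 0 < c → ∀ T : Tower, Φ (Tower.scale c T) = Φ T)
    {Geo : ℤ[X] → Prop} {q : ℕ}
    (hHT : ∀ (g : ℕ) (h : ℤ[X]), 1 ≤ g → h.Monic → h.natDegree = 2 * g →
      (∀ i j, i + j = 2 * g → (q : ℤ) ^ g * h.coeff j = (q : ℤ) ^ i * h.coeff i) →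
      (∀ α ∈ frobRoots h, ‖α‖ = Real.sqrt q) → ∃ E : ℕ, 0 < E ∧ Geo (h ^ E))
    (hGeo : ∀ h, Geo h → Φ (weilWindowTower (q : ℝ) h))
    {g : ℕ} {h : ℤ[X]} (hg : 1 ≤ g) (hh : h.Monic) (hdeg : h.natDegree = 2 * g)
    (hFE : ∀ i j, i + j = 2 * g → (q : ℤ) ^ g * h.coeff j = (q : ℤ) ^ i * h.coeff i)
    (hRH : ∀ α ∈ frobRoots h, ‖α‖ = Real.sqrt q) :
    Φ (weilWindowTower (q : ℝ) h) := by
  obtain ⟨E, hE, hGE⟩ := hHT g h hg hh hdeg hFE hRH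
  rw [← scaleInvariant_eq_of_pow hΦ (q : ℝ) h hE]
  exact hGeo _ hGE

/-- THE SCALE-FREE HULL OF THE GEOMETRIC DATA FORCES RH.  Under Weil (`hW`), an honest datum accepted by EVERY
scale-free reader that is true on all geometric data satisfies RH — tested by the single minor reader
`∀ n, |K(n)| ≤ K(0)` and part 1's converse Weil criterion. [folklore] -/
theorem ffRH_of_scaleFree_hull {Geo : ℤ[X] → Prop} {q : ℕ} (hq : 0 < q)
    (hW : ∀ h, Geo h → ∀ α ∈ frobRoots h, ‖α‖ = Real.sqrt q)
    {g : ℕ} {h : ℤ[X]} (hdeg : h.natDegree = 2 * g)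
    (hFE : ∀ i j, i + j = 2 * g → (q : ℤ) ^ g * h.coeff j = (q : ℤ) ^ i * h.coeff i)
    (hhull : ∀ Φ : Tower → Prop, (∀ c : ℝ, 0 < c → ∀ T : Tower, Φ (Tower.scale c T) = Φ T) →
      (∀ h', Geo h' → Φ (weilWindowTower (q : ℝ) h')) → Φ (weilWindowTower (q : ℝ) h)) :
    ∀ α ∈ frobRoots h, ‖α‖ = Real.sqrt q := by
  have hqR : (0 : ℝ) < q := by exact_mod_cast hq
  have key : ∀ n, ‖weilWindowTower (q : ℝ) h n 0 (Fin.last n)‖ ≤ ‖weilWindowTower (q : ℝ) h 0 0 0‖ :=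
    hhull (fun T : Tower => ∀ n, ‖T n 0 (Fin.last n)‖ ≤ ‖T 0 0 0‖) minorReader_scaleInvariant
      (fun h' hG => by
        intro n
        rw [weilWindowTower_corner, weilWindowTower_corner_zero]
        exact ffKernel_norm_le_of_ffRH hqR (hW h' hG) n)
  refine ffRH_of_ffKernel_norm_le hq hdeg hFE fun n => ?_
  have := key n
  rwa [weilWindowTower_corner, weilWindowTower_corner_zero] at this

/-- FF-DOOR (i), SCALE-FREE HALF, HULL FORM: under Weil and Honda–Tate, for an honest datum `(q,h)`,
`(every scale-free reader true on all geometric data accepts (q,h)) ↔ RH(q,h)` — the window tower modulo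
scale carries RH and nothing finer; no scale-free reader separates "geometric" from "honest + RH". [folklore] -/
theorem scaleFree_hull_iff_ffRH {Geo : ℤ[X] → Prop} {q : ℕ} (hq : 0 < q)
    (hW : ∀ h, Geo h → ∀ α ∈ frobRoots h, ‖α‖ = Real.sqrt q)
    (hHT : ∀ (g : ℕ) (h : ℤ[X]), 1 ≤ g → h.Monic → h.natDegree = 2 * g →
      (∀ i j, i + j = 2 * g → (q : ℤ) ^ g * h.coeff j = (q : ℤ) ^ i * h.coeff i) →
      (∀ α ∈ frobRoots h, ‖α‖ = Real.sqrt q) → ∃ E : ℕ, 0 < E ∧ Geo (h ^ E))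
    {g : ℕ} {h : ℤ[X]} (hg : 1 ≤ g) (hh : h.Monic) (hdeg : h.natDegree = 2 * g)
    (hFE : ∀ i j, i + j = 2 * g → (q : ℤ) ^ g * h.coeff j = (q : ℤ) ^ i * h.coeff i) :
    (∀ Φ : Tower → Prop, (∀ c : ℝ, 0 < c → ∀ T : Tower, Φ (Tower.scale c T) = Φ T) →
      (∀ h', Geo h' → Φ (weilWindowTower (q : ℝ) h')) → Φ (weilWindowTower (q : ℝ) h))
      ↔ ∀ α ∈ frobRoots h, ‖α‖ = Real.sqrt q :=
  ⟨ffRH_of_scaleFree_hull hq hW hdeg hFE,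
    fun hRH _ hΦ hGeo => scaleFree_accepts_of_ffRH hΦ hHT hGeo hg hh hdeg hFE hRH⟩

/-- FF-DOOR (i), SCALE-FREE HALF, DICHOTOMY: under Honda–Tate, a scale-free reader true on all geometric data
EITHER accepts some honest datum violating RH (it is matched by an RH-false fake), OR is EQUIVALENT to RH on
honest data (not merely implies it). [folklore] -/
theorem scaleFree_dichotomy {Φ : Tower → Prop}
    (hΦ : ∀ c : ℝ, 0 < c → ∀ T : Tower, Φ (Tower.scale c T) = Φ T)
    {Geo : ℤ[X] → Prop} {q : ℕ}
    (hHT : ∀ (g : ℕ) (h : ℤ[X]), 1 ≤ g → h.Monic → h.natDegree = 2 * g →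
      (∀ i j, i + j = 2 * g → (q : ℤ) ^ g * h.coeff j = (q : ℤ) ^ i * h.coeff i) →
      (∀ α ∈ frobRoots h, ‖α‖ = Real.sqrt q) → ∃ E : ℕ, 0 < E ∧ Geo (h ^ E))
    (hGeo : ∀ h, Geo h → Φ (weilWindowTower (q : ℝ) h)) :
    (∃ (g : ℕ) (h : ℤ[X]), 1 ≤ g ∧ h.Monic ∧ h.natDegree = 2 * g ∧
        (∀ i j, i + j = 2 * g → (q : ℤ) ^ g * h.coeff j = (q : ℤ) ^ i * h.coeff i) ∧
        (¬ ∀ α ∈ frobRoots h, ‖α‖ = Real.sqrt q) ∧ Φ (weilWindowTower (q : ℝ) h)) ∨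
      (∀ (g : ℕ) (h : ℤ[X]), 1 ≤ g → h.Monic → h.natDegree = 2 * g →
        (∀ i j, i + j = 2 * g → (q : ℤ) ^ g * h.coeff j = (q : ℤ) ^ i * h.coeff i) →
        (Φ (weilWindowTower (q : ℝ) h) ↔ ∀ α ∈ frobRoots h, ‖α‖ = Real.sqrt q)) := by
  refine or_iff_not_imp_left.2 fun H g h hg hh hdeg hFE => ⟨fun hΦh => ?_,
    fun hRH => scaleFree_accepts_of_ffRH hΦ hHT hGeo hg hh hdeg hFE hRH⟩
  by_contra hn
  exact H ⟨g, h, hg, hh, hdeg, hFE, hn, hΦh⟩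

/-- FF-DOOR THEOREM (i), SCALE-FREE READERS — packaged: under Honda–Tate (power form), a scale-free predicate of
the window tower that holds for all geometric data (1) is MATCHED by every honest RH-true fake, and (2) is
matched by an honest RH-false fake OR coincides with RH on honest data. [folklore] -/
theorem ffDoor_scaleFree {Φ : Tower → Prop}
    (hΦ : ∀ c : ℝ, 0 < c → ∀ T : Tower, Φ (Tower.scale c T) = Φ T)
    {Geo : ℤ[X] → Prop} {q : ℕ}
    (hHT : ∀ (g : ℕ) (h : ℤ[X]), 1 ≤ g → h.Monic → h.natDegree = 2 * g →
      (∀ i j, i + j = 2 * g → (q : ℤ) ^ g * h.coeff j = (q : ℤ) ^ i * h.coeff i) →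
      (∀ α ∈ frobRoots h, ‖α‖ = Real.sqrt q) → ∃ E : ℕ, 0 < E ∧ Geo (h ^ E))
    (hGeo : ∀ h, Geo h → Φ (weilWindowTower (q : ℝ) h)) :
    (∀ (g : ℕ) (h : ℤ[X]), 1 ≤ g → h.Monic → h.natDegree = 2 * g →
        (∀ i j, i + j = 2 * g → (q : ℤ) ^ g * h.coeff j = (q : ℤ) ^ i * h.coeff i) →
        (∀ α ∈ frobRoots h, ‖α‖ = Real.sqrt q) → Φ (weilWindowTower (q : ℝ) h)) ∧
    ((∃ (g : ℕ) (h : ℤ[X]), 1 ≤ g ∧ h.Monic ∧ h.natDegree = 2 * g ∧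
        (∀ i j, i + j = 2 * g → (q : ℤ) ^ g * h.coeff j = (q : ℤ) ^ i * h.coeff i) ∧
        (¬ ∀ α ∈ frobRoots h, ‖α‖ = Real.sqrt q) ∧ Φ (weilWindowTower (q : ℝ) h)) ∨
      (∀ (g : ℕ) (h : ℤ[X]), 1 ≤ g → h.Monic → h.natDegree = 2 * g →
        (∀ i j, i + j = 2 * g → (q : ℤ) ^ g * h.coeff j = (q : ℤ) ^ i * h.coeff i) →
        (Φ (weilWindowTower (q : ℝ) h) ↔ ∀ α ∈ frobRoots h, ‖α‖ = Real.sqrt q))) :=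
  ⟨fun _ _ hg hh hdeg hFE hRH => scaleFree_accepts_of_ffRH hΦ hHT hGeo hg hh hdeg hFE hRH,
    scaleFree_dichotomy hΦ hHT hGeo⟩

end Summit.RiemannHypothesis.RiemannHypothesis.Theorems.MotivicDoor.FunctionField

end
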